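import Summits.RiemannHypothesis.RiemannHypothesis.Theses.IntegerScrew
import Literature.NumberTheory.LFunctions.ZetaScrewThm12Proofs
import HarnessLib

/-!
# Route IntegerScrew — `ScrewConverse` (item stmt-RiemannHypothesis-15761)

CALIBRATION: RH ⇒ the target.  Under RH every real quadratic form of Suzuki's kernel is
non-negative (`ZetaScrewThm12.sum_sum_kernel_nonneg`, the necessity half of Suzuki2023 Thm 1.2,
PROVED in the tree from Thm 1.1 (2)); in particular on log-integer configurations.
-/

-- `Summit.RiemannHypothesis.RiemannHypothesis.…` duplicates `RiemannHypothesis` BY DESIGN (D-0017).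
set_option linter.dupNamespace false

namespace Summit.RiemannHypothesis.RiemannHypothesis.Theorems

open Literature.NumberTheory.LFunctions

/-- **`ScrewConverse`** (route IntegerScrew, item stmt-RiemannHypothesis-15761): the Riemann
hypothesis implies that Suzuki's kernel `G(t,u) = Ψ(t) + Ψ(u) − Ψ(t−u)` is positive semidefinite on
every finite configuration of logarithms of positive integers (indeed on every real configuration,
Suzuki2023 Thm 1.2 / (1.9)). -/
theorem screwConverse_proof :
    Summit.RiemannHypothesis.RiemannHypothesis.Theses.IntegerScrew.ScrewConverse :=
  fun hRH _ t x _ => ZetaScrewThm12.sum_sum_kernel_nonneg hRH t x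

end Summit.RiemannHypothesis.RiemannHypothesis.Theorems
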